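import Literature.AlgebraicGeometry.Frobenioids.ArchimedeanPerfectionUnitsRoots
import Literature.AlgebraicGeometry.Frobenioids.ArchimedeanModelType
import Literature.AlgebraicGeometry.Frobenioids.ArchimedeanUnitMonoids
import Literature.AlgebraicGeometry.Frobenioids.PerfectionProd
import Literature.AlgebraicGeometry.Frobenioids.PerfectionGroupificationEquiv
import Literature.AlgebraicGeometry.Frobenioids.BiratUnitsSplit
import Literature.AlgebraicGeometry.Frobenioids.BiratUnitsIntertwinesRoots
import Literature.AlgebraicGeometry.Frobenioids.BiratUnitsConjugation
import Literature.AlgebraicGeometry.Frobenioids.Thm36SubProofs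
import HarnessLib

/-!
# Frobenioids II, Thm. 3.6 (i) at `Λ = ℚ`: the rational function monoid of `C^ℚ = C^pf` IS
# `(Φ^fld)^ℚ = (Φ^gp × Φ^∡)^pf` — assembly of the identification from a radial section (FILE B-arch, part 2a)

Mochizuki, *The geometry of Frobenioids II: poly-Frobenioids*, Kyushu J. Math. **62** (2008) 401–460, §3,
Theorem 3.6 (i), kurims text p. 36 ll. 34–35: "`(C^Λ)^istr` is of … model type, with rational function monoid
naturally isomorphic to `(Φ^fld)^Λ`", `(Φ^fld)^ℚ := (Φ^fld)^pf`, `Φ^fld := Φ^gp × Φ^∡`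
[cite: MochizukiFrdII2008, Thm 3.6 (i) p.36]; [FrdI] Prop. 4.4 (ii)/(iii) p. 83 (the rational function
monoid `O^×(A^birat)`, its divisor map and units) [cite: MochizukiFrdI2008, Prop. 4.4 (iii) p.83].

abc-iut cell, layer L1, row M13-c3 «FILE B-arch» (HOME/staging/L1/L1-t6/g3/M13-c3-DESIGN.md; seat
abc-iut-L1-t6), part 2a = everything that does NOT depend on the radial germs of FILE A (seat abc-iut-w5-d246),
which enter through the PARAMETER `σ` below.  For `X = (A, n) ∈ Ob(C^pf)` over `d = A_D`, `K = π(d)`: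
* `isoOfSection X σ hσ : Perfection (Φ^gp(d) × O_K^×) ≃* O^×(X^birat)` — given a multiplicative SECTION
  `σ : (Φ^pf)^gp(d) → O^×(X^birat)` of the divisor map (`divHom ∘ σ = id`; the radial germs), the composite
  `(Φ^gp × O_K^×)^pf ≃ (Φ^gp)^pf × (O_K^×)^pf` (abc-iut-w5-d194 `Perfection.prodMulEquiv`)
  `≃ (Φ^pf)^gp × O^×(X)` (`gpPerfMulEquiv`, and `unitsPerfEquiv` of part 1)
  `≃ O^×(X^birat)` (`BiratUnits.splitProd`: units × section, abc-iut-w5-d194; `O^×(X^birat)` is abelian since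
  `C^pf` is of model type, `pf_isOfModelType`);
* `isoOfSection_of` — its value on generators: `[(z, w)] ↦ (unit of value w ⊗ 1) · σ((ι^gp) z)`;
* `divHom_isoOfSection` — compatibility with divisors: `Div ∘ iso = (ι^gp)^pf ∘ pr₁^pf = Div_Q`
  (`divPerfection (fieldMonoidToGp (Φ π) π)` of `PerfectionGroupification.lean`), i.e. the field `div_iso` of
  [FrdI] Thm. 5.2 (iv)'s `RationalFunctionMonoidStr` at `B = (Φ^fld)^pf`;
* `intertwines_isoOfSection` — the field `natural` (intertwining along linear arrows of `C^pf`) REDUCED, via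
  abc-iut-w5-d194's `intertwines_perfection_of_forall_of`, to the two generator cases: radial germs
  (hypothesis `hrad`, FILE A) and unit germs (hypothesis `hunit`).
Part 2b instantiates `σ` with FILE A's germs and discharges `hrad`/`hunit`.  Data `def` (`isoOfSection`); no
`def … : Prop`; [FrdII] §3 classical; nothing here bears on [IUTchIII] Cor. 3.12.
-/

noncomputable section

namespace Literature.AlgebraicGeometry.Frobenioids

open CategoryTheory Opposite
open scoped TensorProduct

namespace ArchFrd

namespace Thm36Sub

universe v u

variable {D : Type u} [Category.{v} D] {π : D ⥤ D0}
variable {hF : PreFrobenioid.IsFrobenioid (C.toElem π)}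

open PreFrobenioid PreFrobenioid.Perfection

/-! ### `O^×(X^birat)` for `X ∈ Ob(C^pf)` is abelian -/

/-- `O^×(X^birat)` is commutative for every object `X` of THE perfection (birationally Frobenius-normalized,
`pf_isOfModelType`). [cite: MochizukiFrdI2008, Rem. 1.3.1 p.25] -/
theorem biratUnits_mul_comm (X : pfCat π hF)
    (x y : BiratUnits (pfStr π hF) (pf_isFrobenioid π hF) X) : x * y = y * x :=
  BiratUnits.mul_comm_of_isBiratFrobeniusNormalized ((pf_isOfModelType π hF).2 X) x y

/-! ### The identification `(Φ^gp(d) × O_K^×)^pf ≃ O^×(X^birat)` from a radial section -/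

variable (X : pfCat π hF)

/-- **`(Φ^fld)^pf(d) ≃* O^×(X^birat)` from a radial section `σ`** (see the module docstring for the chain).
[cite: MochizukiFrdII2008, Thm 3.6 (i) p.36] -/
def isoOfSection (σ : PhiGp (pfStr π hF) X →* BiratUnits (pfStr π hF) (pf_isFrobenioid π hF) X)
    (hσ : ∀ x, BiratUnits.divHom (pf_isFrobenioid π hF) X (σ x) = x) :
    Perfection (Algebra.GrothendieckGroup ((Φ π).obj (op X.obj.snd)) × D0.unitScalars (π.obj X.obj.snd)) ≃*
      BiratUnits (pfStr π hF) (pf_isFrobenioid π hF) X :=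
  Perfection.prodMulEquiv.trans <|
    ((show Perfection (Algebra.GrothendieckGroup ((Φ π).obj (op X.obj.snd))) ≃* PhiGp (pfStr π hF) X from
        gpPerfMulEquiv ((Φ π).obj (op X.obj.snd))).prodCongr (unitsPerfEquiv X)).trans <|
      (MulEquiv.prodComm (M := PhiGp (pfStr π hF) X) (N := unitsSubgroup (pfStr π hF) X)).trans
        (BiratUnits.splitProd σ hσ fun _ _ => biratUnits_mul_comm X _ _).symm

/-- `isoOfSection` on a class `[(z, w)]^{1/c}`… it suffices to know it on `(Φ^gp × O_K^×) ⊆ (…)^pf`: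
**`iso [(z, w)] = ι(unit of value w ⊗ 1) · σ((ι_Φ)^gp z)`**. [cite: MochizukiFrdII2008, Thm 3.6 (i) p.36] -/
theorem isoOfSection_of (σ : PhiGp (pfStr π hF) X →* BiratUnits (pfStr π hF) (pf_isFrobenioid π hF) X)
    (hσ : ∀ x, BiratUnits.divHom (pf_isFrobenioid π hF) X (σ x) = x)
    (z : Algebra.GrothendieckGroup ((Φ π).obj (op X.obj.snd))) (w : D0.unitScalars (π.obj X.obj.snd)) :
    isoOfSection X σ hσ (Perfection.of _ (z, w)) =
      BiratUnits.unitsToBirat (pf_isFrobenioid π hF) X (unitsPerfEquiv X (Perfection.of _ w)) *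
        σ (gpMap (Perfection.of ((Φ π).obj (op X.obj.snd))) z) := by
  unfold isoOfSection
  rw [MulEquiv.trans_apply, MulEquiv.trans_apply, MulEquiv.trans_apply, Perfection.prodMulEquiv_of,
    BiratUnits.splitProd_symm_apply]
  change BiratUnits.unitsToBirat _ X (unitsPerfEquiv X (Perfection.of _ w)) *
      σ (gpPerfMulEquiv ((Φ π).obj (op X.obj.snd)) (Perfection.of _ z)) = _
  rw [gpPerfMulEquiv_apply, gpPerfComparison_of]

/-- A general element: `iso b = ι(unitsPerfEquiv (pr₂^pf b)) · σ(interchange (pr₁^pf b))`.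
[cite: MochizukiFrdII2008, Thm 3.6 (i) p.36] -/
theorem isoOfSection_apply (σ : PhiGp (pfStr π hF) X →* BiratUnits (pfStr π hF) (pf_isFrobenioid π hF) X)
    (hσ : ∀ x, BiratUnits.divHom (pf_isFrobenioid π hF) X (σ x) = x)
    (b : Perfection (Algebra.GrothendieckGroup ((Φ π).obj (op X.obj.snd)) × D0.unitScalars (π.obj X.obj.snd))) :
    isoOfSection X σ hσ b =
      BiratUnits.unitsToBirat (pf_isFrobenioid π hF) X (unitsPerfEquiv X (Perfection.map (MonoidHom.snd _ _) b)) *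
        σ (gpPerfComparison ((Φ π).obj (op X.obj.snd)) (Perfection.map (MonoidHom.fst _ _) b)) := by
  unfold isoOfSection
  rw [MulEquiv.trans_apply, MulEquiv.trans_apply, MulEquiv.trans_apply, Perfection.prodMulEquiv_apply,
    Perfection.toProd_apply_eq, BiratUnits.splitProd_symm_apply]
  rfl

/-- **Compatibility with divisors** (`div_iso` of Thm. 5.2 (iv)'s structure): `Div(iso b) = (ι^gp ∘ pr₁)^pf b`,
the value of `Div_Q = divPerfection (fieldMonoidToGp Φ π)` at `b`. [cite: MochizukiFrdI2008, Prop. 4.4 (iii) p.83] -/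
theorem divHom_isoOfSection (σ : PhiGp (pfStr π hF) X →* BiratUnits (pfStr π hF) (pf_isFrobenioid π hF) X)
    (hσ : ∀ x, BiratUnits.divHom (pf_isFrobenioid π hF) X (σ x) = x)
    (b : Perfection (Algebra.GrothendieckGroup ((Φ π).obj (op X.obj.snd)) × D0.unitScalars (π.obj X.obj.snd))) :
    BiratUnits.divHom (pf_isFrobenioid π hF) X (isoOfSection X σ hσ b) =
      gpPerfComparison ((Φ π).obj (op X.obj.snd)) (Perfection.map (MonoidHom.fst _ _) b) := by
  rw [isoOfSection_apply, map_mul, BiratUnits.divHom_unitsToBirat, one_mul, hσ]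

/-- The same, spelled with `Div_Q = divPerfection (fieldMonoidToGp (Φ π) π)` at `d = A_D` — literally the
`div_iso` field for `B = (Φ^fld)^pf = perfectionFunctor (fieldMonoid (Φ π) π)`. [cite: MochizukiFrdI2008, Thm. 5.2(iv) p.101] -/
theorem divHom_isoOfSection_eq_divPerfection
    (σ : PhiGp (pfStr π hF) X →* BiratUnits (pfStr π hF) (pf_isFrobenioid π hF) X)
    (hσ : ∀ x, BiratUnits.divHom (pf_isFrobenioid π hF) X (σ x) = x)
    (b : (perfectionFunctor (fieldMonoid (Φ π) π)).obj (op X.obj.snd)) :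
    BiratUnits.divHom (pf_isFrobenioid π hF) X (isoOfSection X σ hσ b) =
      ((divPerfection (fieldMonoidToGp (Φ π) π)).app (op X.obj.snd)).hom b :=
  divHom_isoOfSection X σ hσ b

/-! ### Naturality along linear arrows, reduced to the radial and the unit generators -/

/-- `O^×(X^birat)` has injective power maps (it is isomorphic, by `isoOfSection`, to a perfection).
[cite: MochizukiFrdI2008, §0 p.11] -/
theorem biratUnits_pow_injective (σ : PhiGp (pfStr π hF) X →* BiratUnits (pfStr π hF) (pf_isFrobenioid π hF) X)
    (hσ : ∀ x, BiratUnits.divHom (pf_isFrobenioid π hF) X (σ x) = x) (n : ℕ) (hn : 0 < n) :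
    Function.Injective fun x : BiratUnits (pfStr π hF) (pf_isFrobenioid π hF) X => x ^ n :=
  injective_pow_of_mulEquiv (isoOfSection X σ hσ).symm (injective_pow_of_isPerfect isPerfect_perfection hn)

variable {X}

/-- **Naturality of the identification along a linear arrow `ψ : X → X'` of `C^pf`**, reduced to generators:
if the radial germs (`hrad`) and the unit germs (`hunit`) are intertwined along `ψ`, then
`iso_X ((Φ^fld)^pf(Base ψ) b')` and `iso_{X'} b'` are intertwined for every `b'` — the field `natural` of
[FrdI] Thm. 5.2 (iv)'s `RationalFunctionMonoidStr` at `B = (Φ^fld)^pf`. [cite: MochizukiFrdI2008, Prop. 2.2(ii) p.45] -/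
theorem intertwines_isoOfSection {X X' : pfCat π hF} (ψ : X ⟶ X') (hψ : IsLinear (pfStr π hF) ψ)
    (σ : PhiGp (pfStr π hF) X →* BiratUnits (pfStr π hF) (pf_isFrobenioid π hF) X)
    (hσ : ∀ x, BiratUnits.divHom (pf_isFrobenioid π hF) X (σ x) = x)
    (σ' : PhiGp (pfStr π hF) X' →* BiratUnits (pfStr π hF) (pf_isFrobenioid π hF) X')
    (hσ' : ∀ x, BiratUnits.divHom (pf_isFrobenioid π hF) X' (σ' x) = x)
    (hrad : ∀ z : Algebra.GrothendieckGroup ((Φ π).obj (op X'.obj.snd)),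
      BiratUnits.Intertwines (pf_isFrobenioid π hF) ψ
        (σ (gpMap (Perfection.of ((Φ π).obj (op X.obj.snd)))
          (gpMap ((Φ π).map (Base (pfStr π hF) ψ).op).hom z)))
        (σ' (gpMap (Perfection.of ((Φ π).obj (op X'.obj.snd))) z)))
    (hunit : ∀ w : D0.unitScalars (π.obj X'.obj.snd),
      BiratUnits.Intertwines (pf_isFrobenioid π hF) ψ
        (BiratUnits.unitsToBirat (pf_isFrobenioid π hF) X
          (unitsPerfEquiv X (Perfection.of _ (D0.unitPull (π.map (Base (pfStr π hF) ψ)) w))))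
        (BiratUnits.unitsToBirat (pf_isFrobenioid π hF) X' (unitsPerfEquiv X' (Perfection.of _ w))))
    (b' : Perfection (Algebra.GrothendieckGroup ((Φ π).obj (op X'.obj.snd)) × D0.unitScalars (π.obj X'.obj.snd))) :
    BiratUnits.Intertwines (pf_isFrobenioid π hF) ψ
      (isoOfSection X σ hσ (Perfection.map ((fieldMonoid (Φ π) π).map (Base (pfStr π hF) ψ).op).hom b'))
      (isoOfSection X' σ' hσ' b') := by
  have hsq := hasBiratSquares_of_isFrobenioid (pf_isFrobenioid π hF)
  have hiso : IsOfIsotropicType (pfStr π hF) := istrAll_Q_holds π hF (fun h => by cases h)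
  have key := BiratUnits.intertwines_perfection_of_forall_of hsq hiso hψ
    (biratUnits_pow_injective X σ hσ)
    ((isoOfSection X σ hσ).toMonoidHom.comp
      (Perfection.map ((fieldMonoid (Φ π) π).map (Base (pfStr π hF) ψ).op).hom))
    (isoOfSection X' σ' hσ').toMonoidHom (fun p => ?_) b'
  · exact key
  · obtain ⟨z, w⟩ := p
    have e1 := isoOfSection_of X σ hσ (gpMap ((Φ π).map (Base (pfStr π hF) ψ).op).hom z)
      (D0.unitPull (π.map (Base (pfStr π hF) ψ)) w)
    have e2 := isoOfSection_of X' σ' hσ' z w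
    have key2 := BiratUnits.Intertwines.mul hsq (hunit w) (hrad z)
    rw [← e1, ← e2] at key2
    exact key2

end Thm36Sub

end ArchFrd

end Literature.AlgebraicGeometry.Frobenioids

end
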